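import Mathlib
import HarnessLib
import Summits.ResolutionOfSingularities.ResolutionOfSingularities.Theorems.WildQuotientsWildQuotientResolutionS1aKillCertAway
import Summits.ResolutionOfSingularities.ResolutionOfSingularities.Theorems.WildQuotientsWildQuotientResolutionS1aCobordantTransport

/-!
# S1a — THE FREE-MODEL STEP: `R^w` over a localised free base is a localised free model, and so is every producer chart ring

[OURS · L1 W4.5c · lead-1 g13; plan-1 CHAIN v10.40 §4 ASSIGNMENT (iii) «A1Move3Model over the localised base» made GENERAL (serves I-2 move 3 and every
later move of I-3 = MT-D₄), A-KF v1 §2.4 (F-T8) «an explicit presentation … so that identities are checked in a localised polynomial ring», R-F15b (6)]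
— NOT statements of the manuscript; counted 0; AI-level work, weaker than expert review. Crux stmt-ResolutionOfSingularities-17941 `CyclicQuotientFourfolds`,
line `s1a-logminvertex` v13 (`stub_reachLowerInFX`). Pure commutative algebra; stated as EXISTENCE of isomorphisms WITH PINS (no new definitions).

After a move whose producer chart has the free model `L = k[T_ι][1/h]` (✓`a1ModelEquiv` + ✓`chartRingEquivAway` for the first move), the NEXT move's centre is
a family of variables `T_{v i}` with weights `w`, and its cobordant algebra and producer chart rings again have free models with one more variable:
* `cobordantAlgebra_X_comp_eq` — weight-0 absorption: `R^w(k[T_ι]; T_v; w) = R^W(k[T_ι]; T; W)` for the weight function `W` extending `w` by `0`;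
* `cobordantMap_s` — pin `cobordantMap s = s` (with ✓`cobordantMap_u'`, ✓`cobordantMap_algebraMap`);
* ★ `exists_cobordantModelEquiv` — `Ψ : R^w(L; T_v; w) ≃+* k[T_none, T_ι'][1/subst h]` (`subst : T_{v i} ↦ T_none^{w i}·T'_{v i}`, Włodarczyk's `x = s^w x′`) with the
  pins `Ψ(a) = subst a` (`a ∈ k[T_ι]`), `Ψ s = T_none`, `Ψ (T_{v i}t^{w i}) = T'_{v i}` — from ✓`isLocalization_away_cobordantMap` (`R^w(L) = R^w(k[T])[1/h]`)
  and Literature `cobordantAlgebra.affineSpaceEquiv`;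
* ★ `exists_awayAwayEquiv` — `A[1/x][1/y] ≃+* A[1/(x·z)]` over `A` whenever `y` is associated to `z/1` (Mathlib `IsLocalization.Away.mul_of_associated`);
* ★★ `exists_chartFreeModelEquiv` — for a producer chart ring `R^w(L; T_v; w)[c⁻¹]` whose cover element `c` becomes associated to a polynomial `z` in
  the model: `Φ : ChartRing ≃+* k[T_none, T_ι'][1/(subst h · z)]` with the pins `Φ(a) = subst a`, `Φ(s) = T_none`, `Φ(T_{v i}t^{w i}) = T'_{v i}` — so
  K1′ for the next centre (variables again) is ✓`ModelNode.isRegular_algebraMap_X_away`, and generation / characteristic are those of a localised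
  polynomial ring.
-/

set_option linter.dupNamespace false

noncomputable section

open Literature.AlgebraicGeometry.Resolution
open scoped LaurentPolynomial
open MvPolynomial
open Summit.ResolutionOfSingularities.ResolutionOfSingularities.Theorems.WildQuotientResolution.S1
open Summit.ResolutionOfSingularities.ResolutionOfSingularities.Theorems.WildQuotientResolution.S1.CoarseChart
open Summit.ResolutionOfSingularities.ResolutionOfSingularities.Theorems.WildQuotientResolution.S1.PrincipalAway
open Summit.ResolutionOfSingularities.ResolutionOfSingularities.Theorems.WildQuotientResolution.S1.KillCert
open Summit.ResolutionOfSingularities.ResolutionOfSingularities.Theorems.WildQuotientResolution.S1.CobordantTransport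

namespace Summit.ResolutionOfSingularities.ResolutionOfSingularities.Theorems.WildQuotientResolution.S1.FreeModel

/-! ## Weight-0 absorption for a family of variables -/

section Poly

variable (R : Type) [CommRing R] {ι : Type} (W : ι → ℕ) {c : ℕ} (v : Fin c → ι) (w : Fin c → ℕ)
  (hvW : ∀ i, W (v i) = w i) (hW : ∀ l, W l = 0 ∨ ∃ i, v i = l)

include hvW hW in
/-- **`R^w(k[T]; T_v; w) = R^W(k[T]; T; W)`** when `W` extends `w` along `v` by zero. [OURS · L1 W4.5c] -/
theorem cobordantAlgebra_X_comp_eq :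
    cobordantAlgebra ((X : ι → MvPolynomial ι R) ∘ v) w = cobordantAlgebra (cobordantAlgebra.coord R : ι → MvPolynomial ι R) W := by
  refine cobordantAlgebra_eq_of_generators _ _ _ _ (fun i => Or.inr ⟨v i, rfl, hvW i⟩) (fun l => ?_)
  rcases hW l with h | ⟨i, hi⟩
  · exact Or.inl h
  · exact Or.inr ⟨i, by rw [← hi]; rfl, by rw [← hi, hvW]⟩

/-- **The free model of Włodarczyk's model algebra, with pins read on underlying Laurent polynomials** (stated for any subalgebra EQUAL to
`R^W(k[T]; T; W)`, so that no transport along a subalgebra equality is needed downstream): `Ψ₀ : S ≃+* k[T_none, T'_ι]` with `C a ↦ subst a`, `T⁻¹ ↦ T_none`,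
`C(T_l)·T^{W l} ↦ T'_l`. [OURS · L1 W4.5c · (F-T8) models; Włodarczyk Ex. 2.3.3] -/
theorem exists_polyModelEquiv_of_eq (S : Subalgebra (MvPolynomial ι R) (MvPolynomial ι R)[T;T⁻¹])
    (hS : S = cobordantAlgebra (cobordantAlgebra.coord R : ι → MvPolynomial ι R) W) :
    ∃ Ψ₀ : ↥S ≃+* MvPolynomial (Option ι) R,
      (∀ (z : ↥S) (a : MvPolynomial ι R), (z : (MvPolynomial ι R)[T;T⁻¹]) = LaurentPolynomial.C a → Ψ₀ z = cobordantAlgebra.subst R W a) ∧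
      (∀ z : ↥S, (z : (MvPolynomial ι R)[T;T⁻¹]) = LaurentPolynomial.T (-1) → Ψ₀ z = X none) ∧
      (∀ (z : ↥S) (l : ι), (z : (MvPolynomial ι R)[T;T⁻¹]) = LaurentPolynomial.C (X l) * LaurentPolynomial.T (W l : ℤ) → Ψ₀ z = X (some l)) := by
  subst hS
  refine ⟨(cobordantAlgebra.affineSpaceEquiv R W).symm, fun z a hz => ?_, fun z hz => ?_, fun z l hz => ?_⟩
  · rw [RingEquiv.symm_apply_eq]
    refine Subtype.ext ?_
    rw [hz, cobordantAlgebra.affineSpaceEquiv_apply, ← cobordantAlgebra.algebraMap_eq_ofAffineSpace_subst, cobordantAlgebra.coe_algebraMap]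
  · rw [RingEquiv.symm_apply_eq]
    refine Subtype.ext ?_
    rw [hz, cobordantAlgebra.affineSpaceEquiv_apply, cobordantAlgebra.ofAffineSpace_X_none, cobordantAlgebra.coe_s]
  · rw [RingEquiv.symm_apply_eq]
    refine Subtype.ext ?_
    rw [hz, cobordantAlgebra.affineSpaceEquiv_apply, cobordantAlgebra.ofAffineSpace_X_some, cobordantAlgebra.coe_u']

include hvW hW in
/-- ★ **The free model of `R^w(k[T]; T_v; w)`**: `Ψ₀ : R^w ≃+* k[T_none, T'_ι]` with the pins `s ↦ T_none`, `T_{v i}t^{w i} ↦ T'_{v i}`, `a ↦ subst a`.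
[OURS · L1 W4.5c · (F-T8) models; Włodarczyk Ex. 2.3.3] -/
theorem exists_polyModelEquiv :
    ∃ Ψ₀ : ↥(cobordantAlgebra ((X : ι → MvPolynomial ι R) ∘ v) w) ≃+* MvPolynomial (Option ι) R,
      (∀ a : MvPolynomial ι R, Ψ₀ (algebraMap (MvPolynomial ι R) _ a) = cobordantAlgebra.subst R W a) ∧
      Ψ₀ (cobordantAlgebra.s _ w) = X none ∧
      (∀ i, Ψ₀ (cobordantAlgebra.u' ((X : ι → MvPolynomial ι R) ∘ v) w i) = X (some (v i))) := by
  obtain ⟨Ψ₀, ha, hs, hu⟩ := exists_polyModelEquiv_of_eq R W _ (cobordantAlgebra_X_comp_eq R W v w hvW hW)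
  refine ⟨Ψ₀, fun a => ha _ a (cobordantAlgebra.coe_algebraMap _ _ a), hs _ (cobordantAlgebra.coe_s _ _), fun i => hu _ (v i) ?_⟩
  rw [cobordantAlgebra.coe_u', hvW]
  rfl

end Poly

/-! ## Base change to the localised base -/

section Loc

variable {B : Type} [CommRing B] {c : ℕ} (f : Fin c → B) (w : Fin c → ℕ) (h : B)

/-- Pin: `cobordantMap s = s`. -/
theorem cobordantMap_s : cobordantMap f w h (cobordantAlgebra.s f w) = cobordantAlgebra.s (algebraMap B (Localization.Away h) ∘ f) w := by
  refine Subtype.ext ?_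
  rw [coe_cobordantMap, cobordantAlgebra.coe_s, cobordantAlgebra.coe_s]
  have := mapRingHom_C_mul_T (algebraMap B (Localization.Away h)) 1 (-1)
  simp only [map_one, one_mul] at this
  exact this

end Loc

section Model

variable (R : Type) [CommRing R] {ι : Type} (W : ι → ℕ) (hh : MvPolynomial ι R) {c : ℕ} (v : Fin c → ι) (w : Fin c → ℕ)
  (hvW : ∀ i, W (v i) = w i) (hW : ∀ l, W l = 0 ∨ ∃ i, v i = l)
  (f : Fin c → Localization.Away hh) (hf : ∀ i, f i = algebraMap (MvPolynomial ι R) (Localization.Away hh) (X (v i)))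

include hvW hW hf in
/-- ★ **THE FREE MODEL OF `R^w` OVER A LOCALISED FREE BASE.** For `L = k[T_ι][1/h]` and the centre `f i = T_{v i}` (weights `w`; `W` the extension by zero):
`Ψ : R^w(L; f; w) ≃+* k[T_none, T'_ι][1/subst h]` with `Ψ(a) = subst a` for `a ∈ k[T_ι]`, `Ψ s = T_none`, `Ψ(f_i t^{w i}) = T'_{v i}`.
[OURS · L1 W4.5c · (F-T8) models; NOT a statement of the manuscript] -/
theorem exists_cobordantModelEquiv :
    ∃ Ψ : ↥(cobordantAlgebra f w) ≃+* Localization.Away (cobordantAlgebra.subst R W hh),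
      (∀ a : MvPolynomial ι R, Ψ (algebraMap (Localization.Away hh) _ (algebraMap (MvPolynomial ι R) (Localization.Away hh) a)) =
        algebraMap (MvPolynomial (Option ι) R) _ (cobordantAlgebra.subst R W a)) ∧
      Ψ (cobordantAlgebra.s f w) = algebraMap (MvPolynomial (Option ι) R) _ (X none) ∧
      (∀ i, Ψ (cobordantAlgebra.u' f w i) = algebraMap (MvPolynomial (Option ι) R) _ (X (some (v i)))) := by
  obtain ⟨Ψ₀, hΨa, hΨs, hΨu⟩ := exists_polyModelEquiv R W v w hvW hW
  have hf' : f = algebraMap (MvPolynomial ι R) (Localization.Away hh) ∘ ((X : ι → MvPolynomial ι R) ∘ v) := funext hf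
  subst hf'
  -- `R^w(L) = R^w(k[T])[1/h]`
  letI := (cobordantMap ((X : ι → MvPolynomial ι R) ∘ v) w hh).toAlgebra
  haveI := isLocalization_away_cobordantMap ((X : ι → MvPolynomial ι R) ∘ v) w hh
  have H : (Submonoid.powers (algebraMap (MvPolynomial ι R) ↥(cobordantAlgebra ((X : ι → MvPolynomial ι R) ∘ v) w) hh)).map Ψ₀.toMonoidHom =
      Submonoid.powers (cobordantAlgebra.subst R W hh) := by
    rw [Submonoid.map_powers]
    exact congrArg Submonoid.powers (hΨa hh)
  have hΨ₁ : ∀ z, IsLocalization.ringEquivOfRingEquiv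
        (M := Submonoid.powers (algebraMap (MvPolynomial ι R) ↥(cobordantAlgebra ((X : ι → MvPolynomial ι R) ∘ v) w) hh))
        (T := Submonoid.powers (cobordantAlgebra.subst R W hh))
        ↥(cobordantAlgebra (algebraMap (MvPolynomial ι R) (Localization.Away hh) ∘ ((X : ι → MvPolynomial ι R) ∘ v)) w)
        (Localization.Away (cobordantAlgebra.subst R W hh)) Ψ₀ H (cobordantMap ((X : ι → MvPolynomial ι R) ∘ v) w hh z) =
      algebraMap (MvPolynomial (Option ι) R) _ (Ψ₀ z) :=
    fun z => IsLocalization.ringEquivOfRingEquiv_eq H z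
  refine ⟨IsLocalization.ringEquivOfRingEquiv
      (M := Submonoid.powers (algebraMap (MvPolynomial ι R) ↥(cobordantAlgebra ((X : ι → MvPolynomial ι R) ∘ v) w) hh))
      (T := Submonoid.powers (cobordantAlgebra.subst R W hh))
      ↥(cobordantAlgebra (algebraMap (MvPolynomial ι R) (Localization.Away hh) ∘ ((X : ι → MvPolynomial ι R) ∘ v)) w)
      (Localization.Away (cobordantAlgebra.subst R W hh)) Ψ₀ H, fun a => ?_, ?_, fun i => ?_⟩
  · rw [← cobordantMap_algebraMap, hΨ₁, hΨa]
  · rw [← cobordantMap_s, hΨ₁, hΨs]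
  · rw [← cobordantMap_u', hΨ₁, hΨu]

end Model

/-! ## Flattening a localisation of a localisation -/

section AwayAway

/-- ★ **`A[1/x][1/y] ≅ A[1/(x z)]` over `A`** when `y` is associated to `z/1` in `A[1/x]`, with the pin on `A`. [folklore; Mathlib `IsLocalization.Away.mul_of_associated`] -/
theorem exists_awayAwayEquiv {A : Type} [CommRing A] (x : A) (y : Localization.Away x) (z : A)
    (h : Associated (algebraMap A (Localization.Away x) z) y) :
    ∃ Θ : Localization.Away y ≃+* Localization.Away (x * z),
      ∀ a : A, Θ (algebraMap (Localization.Away x) (Localization.Away y) (algebraMap A (Localization.Away x) a)) = algebraMap A (Localization.Away (x * z)) a := by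
  haveI : IsLocalization.Away (x * z) (Localization.Away y) := IsLocalization.Away.mul_of_associated x z y h
  refine ⟨(IsLocalization.algEquiv (Submonoid.powers (x * z)) (Localization.Away y) (Localization.Away (x * z))).toRingEquiv, fun a => ?_⟩
  rw [← IsScalarTower.algebraMap_apply]
  exact (IsLocalization.algEquiv (Submonoid.powers (x * z)) (Localization.Away y) (Localization.Away (x * z))).commutes a

end AwayAway

/-! ## The free model of a producer chart ring over a localised free base -/

section Chart

variable (R : Type) [CommRing R] {ι : Type} (W : ι → ℕ) (hh : MvPolynomial ι R) {c : ℕ} (v : Fin c → ι) (w : Fin c → ℕ)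
  (hvW : ∀ i, W (v i) = w i) (hW : ∀ l, W l = 0 ∨ ∃ i, v i = l)
  (f : Fin c → Localization.Away hh) (hf : ∀ i, f i = algebraMap (MvPolynomial ι R) (Localization.Away hh) (X (v i)))
  {κ : Type} [AddCommGroup κ] [DecidableEq κ] (𝒜 : κ → AddSubgroup (Localization.Away hh)) [GradedRing 𝒜]
  (D : ℕ) (b : ↥(𝒜 0)) (hb : b ∈ (traceFiltration 𝒜 f w).ideal D) (z : MvPolynomial (Option ι) R)
  (hz : ∀ Ψ : ↥(cobordantAlgebra f w) ≃+* Localization.Away (cobordantAlgebra.subst R W hh),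
    (∀ a : MvPolynomial ι R, Ψ (algebraMap (Localization.Away hh) _ (algebraMap (MvPolynomial ι R) (Localization.Away hh) a)) =
        algebraMap (MvPolynomial (Option ι) R) _ (cobordantAlgebra.subst R W a)) →
    Ψ (cobordantAlgebra.s f w) = algebraMap (MvPolynomial (Option ι) R) _ (X none) →
    (∀ i, Ψ (cobordantAlgebra.u' f w i) = algebraMap (MvPolynomial (Option ι) R) _ (X (some (v i)))) →
    Associated (algebraMap (MvPolynomial (Option ι) R) (Localization.Away (cobordantAlgebra.subst R W hh)) z) (Ψ (coverElement 𝒜 f w D b hb)))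

set_option maxHeartbeats 1000000 in
include hvW hW hf hz in
/-- ★★ **THE FREE MODEL OF A PRODUCER CHART RING OVER A LOCALISED FREE BASE.** With the data of `exists_cobordantModelEquiv`, a node grading `𝒜` on `L`, a
cover element `c = bT^D` and a polynomial `z` to which `Ψ c` is associated for every pinned model `Ψ` (hypothesis `hz`, checked on generators):
`Φ : R^w(L; f; w)[c⁻¹] ≃+* k[T_none, T'_ι][1/(subst h · z)]` with the pins `Φ(a) = subst a`, `Φ(s) = T_none`, `Φ(f_i t^{w i}) = T'_{v i}`.
[OURS · L1 W4.5c · (F-T8) models; NOT a statement of the manuscript] -/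
theorem exists_chartFreeModelEquiv :
    ∃ Φ : ChartRing 𝒜 f w D b hb ≃+* Localization.Away (cobordantAlgebra.subst R W hh * z),
      (∀ a : MvPolynomial ι R, Φ (algebraMap ↥(cobordantAlgebra f w) (ChartRing 𝒜 f w D b hb)
          (algebraMap (Localization.Away hh) ↥(cobordantAlgebra f w) (algebraMap (MvPolynomial ι R) (Localization.Away hh) a))) =
        algebraMap (MvPolynomial (Option ι) R) _ (cobordantAlgebra.subst R W a)) ∧
      Φ (algebraMap ↥(cobordantAlgebra f w) (ChartRing 𝒜 f w D b hb) (cobordantAlgebra.s f w)) = algebraMap (MvPolynomial (Option ι) R) _ (X none) ∧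
      (∀ i, Φ (algebraMap ↥(cobordantAlgebra f w) (ChartRing 𝒜 f w D b hb) (cobordantAlgebra.u' f w i)) =
        algebraMap (MvPolynomial (Option ι) R) _ (X (some (v i)))) := by
  obtain ⟨Ψ, hΨa, hΨs, hΨu⟩ := exists_cobordantModelEquiv R W hh v w hvW hW f hf
  have hzΨ : Associated (algebraMap (MvPolynomial (Option ι) R) (Localization.Away (cobordantAlgebra.subst R W hh)) z) (Ψ (coverElement 𝒜 f w D b hb)) :=
    hz Ψ hΨa hΨs hΨu
  obtain ⟨Θ, hΘ⟩ := exists_awayAwayEquiv (A := MvPolynomial (Option ι) R) (cobordantAlgebra.subst R W hh) (Ψ (coverElement 𝒜 f w D b hb)) z hzΨ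
  refine ⟨(chartRingEquivAway 𝒜 f w D b hb Ψ).trans Θ, fun a => ?_, ?_, fun i => ?_⟩
  · rw [RingEquiv.trans_apply, chartRingEquivAway_algebraMap, hΨa, hΘ]
  · rw [RingEquiv.trans_apply, chartRingEquivAway_algebraMap, hΨs, hΘ]
  · rw [RingEquiv.trans_apply, chartRingEquivAway_algebraMap, hΨu, hΘ]

end Chart

end Summit.ResolutionOfSingularities.ResolutionOfSingularities.Theorems.WildQuotientResolution.S1.FreeModel

end
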